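import Mathlib
import HarnessLib
import HarnessLib.Audit
import Summits.Parity.Statement
import Literature.NumberTheory.LFunctions.NoRealZeroUpTo
import Literature.NumberTheory.LFunctions.RealCharacterLadderLeaves
import Literature.NumberTheory.LFunctions.NoRealZeroSmallModuli
import HarnessLib.Audit.Status.Attr

/-!
Route: RealCharacterDecadeTenEven

DORMANT since 2026-09-01T22:40:16Z (reconciler: no traction for 5 d (last activity item-evidence-added at 2026-08-27T21:50:51Z); parked, not closed — `ledger route dormant route-Parity-RealCharacterDecadeTenEven --off` to reactivate) — unstaffed, not closed; items shared with open routes are served there. `ledger route dormant <id> --off` reactivates.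

# Route RealCharacterDecadeTenEven — no real zero for every EVEN quadratic primitive χ mod q ≤ 10¹⁰
(25 000× Platt's printed even range), by two certified decade blocks on top of the 10⁹ ladder

X = "for every modulus 3 ≤ q ≤ 10¹⁰, every primitive quadratic EVEN Dirichlet character χ mod q
(χ(−1) = 1, i.e. χ = χ_d with d > 0, d = q) and every real σ ∈ (0,1), L(σ,χ) ≠ 0"
= the rung leaf `Literature.NumberTheory.LFunctions.NoRealZeroEvenUpTo_1e10` (body
`NoRealZeroEvenUpTo 10000000000`; D-0061 alt-closer
'closes rung F-P2c′ (F-P2c-even) of Parity', listed 2026-08-26T01:48Z). It suffices to show five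
range blocks X = R0 ∧ R1even ∧ R2even ∧ R3lo ∧ R3hi:
the three blocks of the sibling route RealCharacterThetaLadder restricted to even characters (R0 = q
≤ 4·10⁵ Platt's printed range; R1even =
4·10⁵ < q ≤ 10⁸ and R2even = 10⁸ < q ≤ 10⁹, both BEYOND print and two-lineage certified A + BW,
referee-signed — SHARED items, same signatures)
and the two NEW decade blocks R3lo = 10⁹ < q ≤ 6.432·10⁹ (board cells s1–s5 even) and R3hi =
6.432·10⁹ < q ≤ 10¹⁰ (cells s6–s10 even), each
cell certified by the two code-disjoint integer-only lineages C (sweep-3) ∧ BW regime 3 (eng-2) and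
booked per R-1 (two referee-signed lineages per
cell). D-0059 route OF RECORD for the even half of the DATA decade of cell parity-realchar (SIEGEL
INSTRUMENT, D-0070); with the odd sibling
RealCharacterDecadeTen the wide leaf `NoRealZeroUpTo_1e10` (F-P2d) follows by
`noRealZeroUpTo_1e10_iff_odd_and_even`. The blocks are decided by
certified numerics, not kernel proof, and carry that currency label.
Lean: `Literature.NumberTheory.LFunctions.NoRealZeroEvenUpTo 10000000000`

## Assembly
Pure logic: range split q ≤ 4·10⁵ ∨ 4·10⁵ < q ≤ 10⁸ ∨ 10⁸ < q ≤ 10⁹ ∨ 10⁹ < q ≤ 6.432·10⁹ ∨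
6.432·10⁹ < q ≤ 10¹⁰ (`omega`); the deciding theorem
`closes` (glue-E.lean; farm rc 0, 0 sorries in the seat's SketchE.lean) concludes the leaf
`NoRealZeroEvenUpTo_1e10` (= `NoRealZeroEvenUpTo 10000000000`).

CLOSES_TARGET: closes rung F-P2c′ of Parity: Literature.NumberTheory.LFunctions.NoRealZeroEvenUpTo_1e10 (D-0061; not the summit Statement) — the deciding theorem of this route concludes that registered leaf instead of the Statement decl `GeneralizedHardyLittlewood` (class rung: servable and labelled, never counted as concluding the summit Statement).

Rationale: WHY THIS LINE. Mechanism (unchanged from the 10⁹ ladder): a real zero σ ∈ (0,1) of L(s,χ_d) is a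
zero of the completed function Λ_d(σ) = ξ(σ,χ_d), a
theta integral whose positivity on [0,1] is decidable row by row by certified evaluation — lineage
BW regime 3 (integer-only
Bernstein/Chebyshev panel enclosures with an in-job regime-1 second pass) and lineage C
(integer-only, two-end batch interpolation + per-row
exact retry, independently generated tables cross-validated against A's), with lineage A′ (deep
Taylor recheck) as the capstone on each
cell's smallest rows; tree criterion `noRealZeroUpTo_iff_dirichletXi_re_pos` (p403290). Print for
EVEN characters stops at q ≤ 4·10⁵
(Platt2016GRH Thms 7.1–7.2; Chua2005RealZeros Thm 1.1 to 2·10⁵), three orders of magnitude below the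
odd print (Watkins 3·10⁸);
Lu–Zaman–Zhao 2026 (arXiv:2602.03626 Thm 1.1) reach 10¹⁰ for all quadratic χ only in the NARROW
window σ ≥ 1 − 1/(5 log q). What this
route does that the 10⁹ route does not: it types the even decade (10⁹,10¹⁰] — 25 000× the printed
even range, full interval (0,1) — as two
booking blocks aligned with the cell's lineage map, so the even leaf closes the moment the board's
even column is contiguous. Nothing is
imported from another area; no new mathematics is claimed; consumers take the leaf as a hypothesis
(`NoRealZeroEvenUpTo` anti-level lemmas,
central-value positivity, the `_upTo_1e10` vacuity lemmas of HOME/CONDITIONALS.md §4 once re-based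
on the certified leaf).

RANKED CRUXES. #2 EvenHighDecade (crux) — for every modulus 6.432·10⁹ < q ≤ 10¹⁰, every primitive
quadratic EVEN χ mod q and every σ ∈ (0,1), L(σ,χ) ≠ 0 (1 084 541 845 fundamental d > 0, two
independent Möbius counts, referee V66; board cells s6–s10 even; DATA lineage C kit j248379 (s6+s7)
/ j248381 (s8–s10), lineage BW regime 3 even j247457 (5·10⁹, 7.71·10⁹] upper part / j247458
(7.71·10⁹, 10¹⁰]; currency: certified numerics, two code-disjoint integer-only lineages,
referee-signed per cell). [difficulty: L] (why it might fail: false iff an even d with 6.432·10⁹ < d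
≤ 10¹⁰ has a real zero; evidence-side, even Λ_d(1/2) is smallest where h(d) log ε_d is tiny, and
lineage C's batch interpolation at this height is the newest code — a value-level C-vs-BW disjoint
pair voids the block's certificate.) [Platt2016GRH, Chua2005RealZeros, arXiv:2602.03626]
#3 EvenLowDecade (crux) — for every modulus 10⁹ < q ≤ 6.432·10⁹, every primitive quadratic EVEN χ
mod q and every σ ∈ (0,1), L(σ,χ) ≠ 0 (1 651 129 975 fundamental d > 0; board cells s1–s5 even; DATA
lineage C kit j247772 (s1) / j247779 (s2) / j247958 (s3) / j248377 (s4) / j248378 (s5), lineage BW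
regime 3 even j247456 (10⁹, 5·10⁹] / j247457 lower part; currency: certified numerics, two
code-disjoint lineages per cell, referee-signed). [difficulty: L] (why it might fail: false iff an
even d with 10⁹ < d ≤ 6.432·10⁹ has a real zero; in practice the rows with the smallest Λ_d(1/2)
(small regulator × class number) may stay UNCERTIFIED in both integer lineages within budget and
need the A′ deep recheck before the cell books.) [Platt2016GRH, Chua2005RealZeros, arXiv:2602.03626]
#4 EvenToBillion (crux) — for every modulus 10⁸ < q ≤ 10⁹, every primitive quadratic EVEN χ mod q
and every σ ∈ (0,1), L(σ,χ) ≠ 0 — SHARED with route RealCharacterThetaLadder (same signature, item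
stmt-Parity-18821); DATA: two-lineage full width A + BW, referee V32/V34/V35 (607 927 069
fundamental d both parities at 10⁹); currency: certified numerics. [difficulty: L] (why it might
fail: false iff an even d with 10⁸ < d ≤ 10⁹ has a real zero; 2 500× beyond the printed even range,
so the whole block rests on the cell's two lineages (no print to fall back on).) [Platt2016GRH,
Chua2005RealZeros, arXiv:2602.03626, arXiv:2301.10722]
#5 EvenToHundredMillion (crux) — for every modulus 4·10⁵ < q ≤ 10⁸, every primitive quadratic EVEN χ
mod q and every σ ∈ (0,1), L(σ,χ) ≠ 0 — SHARED with route RealCharacterThetaLadder (same signature,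
item stmt-Parity-18822); DATA: lineage A R1 (PASS V13) + lineage BW R1-W, referee-signed; currency:
certified numerics (250× beyond print). [difficulty: M] (why it might fail: false iff an even d with
4·10⁵ < d ≤ 10⁸ has a real zero; unlike the odd block of the same range (inside Watkins' theorem)
nothing printed covers it, so a late value-level disjoint pair between the two lineages would reopen
it.) [Platt2016GRH, Chua2005RealZeros, arXiv:2301.10722]
#9 PlattRange (support) — no real zero in (0,1) for every primitive quadratic χ mod 3 ≤ q ≤ 4·10⁵,
both parities — Platt's printed range (tree `noRealZeroUpTo_platt` modulo the named facts
`platt2016_theorem71/72`) and the cell's STEP-0 (three code-disjoint certified lineages A/BW/C, 243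
171/243 171 fundamental d, referee STEP0-PASS / STEP0-W-PASS / V53); SHARED with route
RealCharacterThetaLadder (item stmt-Parity-18824); kernel sub-range `noRealZeroUpTo_twentyThree`
(p403994). [difficulty: XL] [Platt2016GRH, Watkins2004RealZeros, Chua2005RealZeros]

TWO-LAYER PLAN. Foreseen glued split of each decade block into its board cells only if a cell stalls
(EvenLowDecade ⇐ s1 → s2 → s3 → s4 → s5, boundaries
2.546/3.703/4.699/5.599 ·10⁹; EvenHighDecade ⇐ s6–s7 → s8–s10, boundary 7.955·10⁹; BW's even jobs
cut at 5·10⁹ and 7.71·10⁹, so a cell books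
only when both covering BW jobs and its C job have referee verdicts) — nothing filed now; cells are
engine bookkeeping on HOME/SWEEP-BOARD.md.
With the odd sibling's leaf, `NoRealZeroUpTo_1e10` (F-P2d) follows by
`noRealZeroUpTo_1e10_iff_odd_and_even` (tree, p415610) — a one-line
route or Theorems file when both leaves are closed.

KILL CRITERIA. A certified real zero (an interval on which Λ_d < 0 for some even d ≤ 10¹⁰,
reproduced by a second lineage) refutes the block containing d,
closes the route `refuted:<Block>`, and is a counterexample to Chowla's conjecture. A referee GAP
verdict on an even decade cell (disjoint
value-level enclosures between C and BW, or an UNCERTIFIED row surviving the per-row retry and the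
A′ deep recheck) that is not repaired
inside the cell's envelope (5 500 core-h) forces re-pointing at the 10⁹ leaf (this route goes
dormant, the 10⁹ route stands).

NOT DECOMPOSED YET. No per-cell, per-batch or per-discriminant items (10 cells, ≈ 10⁵ batches):
bookkeeping lives on HOME/SWEEP-BOARD.md and DATA.md. No
items for the odd decade (sibling route RealCharacterDecadeTen, opened 2026-08-26T02:11Z), for the
ξ-positivity form of the blocks
(equivalent by `noRealZeroUpTo_iff_dirichletXi_re_pos`), for the central-value enclosures /
near-miss table (HOME/NEAR-MISS data, not
statements), or for consumers (in tree, leaf as hypothesis). No kernel replay of any decade row is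
planned.

CHEAPEST FALSIFIER. The STEP-0-at-height join: certify one 10⁶-wide even window at the TOP of the
decade, [9 999 000 000, 10 000 000 001), with two code-disjoint
lineages and join the Λ_d(1/2) enclosures value by value — one disjoint pair kills the evidence for
EvenHighDecade (not the statement) and
sends both lineages to audit. Already run: lineage A top window both signs (j246605, ALL_CERTIFIED),
lineage C STEP-0 V53, BW regime-3
STEP-0 V54; the decade-wide joins happen per cell at booking.

NUMBERS. Printed wide frontier (even): q ≤ 4·10⁵ (Platt2016GRH Thms 7.1–7.2), 2·10⁵
(Chua2005RealZeros Thm 1.1); odd print |d| ≤ 3·10⁸ (Watkins).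
Narrow: σ ≥ 1 − 1/(5 log q), all quadratic χ, q ≤ 10¹⁰ (arXiv:2602.03626 Thm 1.1, ≈ 150k core-h).
Cell: N₊(10⁹) = 303 963 559,
N₊(6.432·10⁹) = 1 955 093 534, N₊(10¹⁰) = 3 039 635 379 (two independent Möbius counters + referee
V66) ⇒ EvenLowDecade 1 651 129 975 rows,
EvenHighDecade 1 084 541 845 rows; decade budget ≤ 2 200 core-h all-in (both parities) of the
realchar envelope 5 500 (board R-9); record
small values at 10⁹ (even): min L(1,χ_d) over fundamental 0 < d ≤ 10⁹ = 0.189483 at d = 5 417 453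
(near-miss engine 2, j247270, unbooked).

DEFINITION REQUESTS. None. The leaf `Literature.NumberTheory.LFunctions.NoRealZeroEvenUpTo_1e10 :
Prop := NoRealZeroEvenUpTo 10000000000` is landed (p415610,
RealCharacterLadderLeaves.lean :92) together with `NoRealZeroOddUpTo_1e10`, `NoRealZeroUpTo_1e10`,
`noRealZeroUpTo_1e10_iff_odd_and_even`,
`NoRealZeroUpTo_1e10.to_1e9`.

Novelty: Searches (2026-08-25/26, inherited from the sibling filings and re-run for the decade): lit search
--hybrid "real zeros of quadratic Dirichlet L-functions verified computation discriminant" (textbook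
hits only: Montgomery–Vaughan 2007 p.109, Cohen 1993, Buell 1989); lit search "Landau-Siegel zeros
numerical computations" --source all (local: arXiv:2602.03626 pp.1,16,20; arXiv:2301.10722 p.9;
remote: doi:10.1016/j.jnt.2023.04.008, doi:10.1090/mcom/4268, Sarnak–Zaharescu 2002); lit galaxy
search "real zeros of real|Landau-Siegel zero|no Siegel zero" --star all (21 rows, none a
verification table beyond Watkins/Platt/LZZ; pdf:199087960 Stopple = context); lit read
arxiv:2301.10722 --grep (p.3: "Watkins … q ≤ 3·10⁸ odd, Platt … even q ≤ 4·10⁵").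
Nearest prior art found: Platt2016GRH Thms 7.1–7.2 (even and odd, q ≤ 4·10⁵, rigorous) [corpus: tree
NoRealZeroPrintedFrontier.lean / RobinMorrillPlattRange.lean cites]; Chua2005RealZeros Thm 1.1
(even, d ≤ 2·10⁵) [corpus: tree NoRealZeroPrintedFrontier.lean :61]; arXiv:2602.03626 Thm 1.1
[corpus:arxiv-2602.03626 p.1] (q ≤ 10¹⁰ but NARROW); arXiv:2301.10722 Thm 1 [corpus:arxiv-2301.10722
p.3] (prime q ≤ 10⁷, even, narrow, non-certified).
Delta: the even wide column moves from 4·10⁵ (print) — via the 10⁹ ladder's two certified even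
blocks — to 10¹⁰ with two code-disjoint certified integer-only lineages per cell, typed as two
booking blocks; no new mathematics is claimed.
Claimed grade: variant  [refs: 10.1016/j.jnt.2023.04.008, 10.1090/mcom/4268, 2602.03626, 2301.10722, doi:10.1016/j.jnt.2023.04.008, doi:10.1090/mcom/4268, arxiv:2301.10722, arxiv-2602.03626, arxiv-2301.10722]

Barriers (technique_class: certified-numerics, theta-positivity, interval-arithmetic): - technique_class: certified-numerics, theta-positivity, interval-arithmetic
- Literature.Barriers.Parity.SiegelZeroTwinPrimes: it does not touch it and does not try — a finite
table (q ≤ 10¹⁰) implies nothing about Siegel zeros of unbounded quality or about twin primes (H4/H5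
of the cell); the route is an instrument (explicit exclusion for q ≤ Q), not a summit move.
- Literature.Barriers.Parity.SiegelZeroPrimePairBarrier: outside its class — no shift-uniform
prime-pair bound is claimed or used; the only output is L(σ,χ_d) ≠ 0 on (0,1) for even d ≤ 10¹⁰,
which the barrier neither forbids nor is fed by.
- Literature.Barriers.Parity.BrunTitchmarshSiegelZero: not in its class (no sieve bound is improved;
nothing asymptotic is claimed). (Uncatalogued for Parity but governing the method: the
Epstein/class-sum kernel method
`Literature/Barriers/RiemannHypothesis/EpsteinZetaRealZerosSmallK.lean` is blocked from d ≥ 200 by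
its own scope statement — hence certified numerics, not kernel, above d = 144.)
- Negatives index: empty for these statements at filing (no refuted `NoRealZero*` /
`NoExceptionalZero*` instance in `ledger negatives --problem Parity`, 4 unrelated Parity negatives;
the A1 episode — `NoExceptionalZeroUpTo` without `0 < σ` false via L(−1,χ₃) = 0 — is built into the
landed definitions).

History (route lifecycle, newest last):
- 2026-09-01T22:40:16Z · DORMANT — reconciler: no traction for 5 d (last activity item-evidence-added at 2026-08-27T21:50:51Z); parked, not closed — `ledger route dormant route-Parity-RealCharact (operator:999:251170)

sub-problem: GeneralizedHardyLittlewood · status: dormant · opened planner-parity-realchar-theory-g5-0 2026-08-26T02:32:04Z · rev 1 · ledger route-Parity-RealCharacterDecadeTenEven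
GENERATED by the gate from the ledger (D-0016/17). Provers cite these decls: `theorem foo : Summit.Parity.GeneralizedHardyLittlewood.Theses.RealCharacterDecadeTenEven.<Decl> := …` in Summits/Parity/GeneralizedHardyLittlewood/Theorems/<Name>.lean.
-/

namespace Summit.Parity.GeneralizedHardyLittlewood.Theses.RealCharacterDecadeTenEven

open scoped BigOperators Topology Manifold Classical MeasureTheory ProbabilityTheory Matrix InnerProductSpace ComplexConjugate ContinuousMap
open Filter Set Function TopologicalSpace MeasureTheory

attribute [summit_statement] _root_.GeneralizedHardyLittlewood
attribute [summit_statement] _root_.Literature.NumberTheory.LFunctions.NoRealZeroEvenUpTo_1e10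

/-- item stmt-Parity-19226 · crux · rank 2 · open · by planner
why it might fail: false iff an even d with 6.432·10⁹ < d ≤ 10¹⁰ has a real zero; evidence-side, even Λ_d(1/2) is smallest where h(d) log ε_d is tiny, and lineage C's batch interpolation at this height is the newest code — a value-level C-vs-BW disjoint pair voids the block's certificate.
sources: Platt2016GRH, Chua2005RealZeros, arXiv:2602.03626
[crux] for every modulus 6.432·10⁹ < q ≤ 10¹⁰, every primitive quadratic EVEN χ mod q and every σ ∈
(0,1), L(σ,χ) ≠ 0 (1 084 541 845 fundamental d > 0, two independent Möbius counts, referee V66;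
board cells s6–s10 even; DATA lineage C kit j248379 (s6+s7) / j248381 (s8–s10), lineage BW regime 3
even j247457 (5·10⁹, 7.71·10⁹] upper part / j247458 (7.71·10⁹, 10¹⁰]; currency: certified numerics,
two code-disjoint integer-only lineages, referee-signed per cell). [difficulty: L] -/
@[route_item "route-Parity-RealCharacterDecadeTenEven", crux]
def EvenHighDecade : Prop :=
  ∀ (q : ℕ) [NeZero q], 6432000000 < q → q ≤ 10000000000 → ∀ χ : DirichletCharacter ℂ q, χ.IsQuadratic → χ.IsPrimitive → χ.Even → ∀ σ : ℝ, 0 < σ → σ < 1 → χ.LFunction σ ≠ 0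

/-- item stmt-Parity-19227 · crux · rank 3 · open · by planner
why it might fail: false iff an even d with 10⁹ < d ≤ 6.432·10⁹ has a real zero; in practice the rows with the smallest Λ_d(1/2) (small regulator × class number) may stay UNCERTIFIED in both integer lineages within budget and need the A′ deep recheck before the cell books.
sources: Platt2016GRH, Chua2005RealZeros, arXiv:2602.03626
[crux] for every modulus 10⁹ < q ≤ 6.432·10⁹, every primitive quadratic EVEN χ mod q and every σ ∈
(0,1), L(σ,χ) ≠ 0 (1 651 129 975 fundamental d > 0; board cells s1–s5 even; DATA lineage C kit
j247772 (s1) / j247779 (s2) / j247958 (s3) / j248377 (s4) / j248378 (s5), lineage BW regime 3 even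
j247456 (10⁹, 5·10⁹] / j247457 lower part; currency: certified numerics, two code-disjoint lineages
per cell, referee-signed). [difficulty: L] -/
@[route_item "route-Parity-RealCharacterDecadeTenEven", crux]
def EvenLowDecade : Prop :=
  ∀ (q : ℕ) [NeZero q], 1000000000 < q → q ≤ 6432000000 → ∀ χ : DirichletCharacter ℂ q, χ.IsQuadratic → χ.IsPrimitive → χ.Even → ∀ σ : ℝ, 0 < σ → σ < 1 → χ.LFunction σ ≠ 0

/-- item stmt-Parity-18821 · crux · rank 4 · open · by planner
why it might fail: false iff an even d with 10⁸ < d ≤ 10⁹ has a real zero; 2 500× beyond the printed even range, so the whole block rests on the cell's two lineages (no print to fall back on).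
sources: Platt2016GRH, Chua2005RealZeros, arXiv:2602.03626, arXiv:2301.10722
for every modulus 10⁸ < q ≤ 10⁹, every primitive quadratic EVEN χ mod q and every σ ∈ (0,1), L(σ,χ)
≠ 0 (2 500× beyond the printed even range). BOOKED in the route's currency (certified numerics, two
code-disjoint referee-signed lineages; text refreshed 2026-08-26 per tribunal №10 (4), statement
unchanged): lineage A regime 2 v2e (kit j242929/j242932/j242934/j242936 + R0/R1; referee V34 PASS
«all 607 927 069 primitive quadratic characters of conductor ≤ 10⁹ (303 963 559 even + 303 963 510
odd) certified free of real zeros in (0,1)») ∧ lineage BW R2-W even (six jobs + cross-check, 18 938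
windows tiling [10⁸+1, 10⁹+1) exactly; referee V32 PASS; V32-A two-sided BW enclosure at the even
argmin d = 402 791 045, L(½) ∈ [3.208, 3.291]·10⁻⁶ ∋ A's 3.2494·10⁻⁶). Closing bundle attached to
stmt-Parity-18821; the item stays OPEN+BOOKED (D1–D3) and closes in the ledger sense only on a
kernel replay. -/
@[route_item "route-Parity-RealCharacterDecadeTenEven", crux]
def EvenToBillion : Prop :=
  ∀ (q : ℕ) [NeZero q], 100000000 < q → q ≤ 1000000000 → ∀ χ : DirichletCharacter ℂ q, χ.IsQuadratic → χ.IsPrimitive → χ.Even → ∀ σ : ℝ, 0 < σ → σ < 1 → χ.LFunction σ ≠ 0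

/-- item stmt-Parity-18822 · crux · rank 5 · open · by planner
why it might fail: false iff an even d with 4·10⁵ < d ≤ 10⁸ has a real zero; unlike the odd block of the same range (inside Watkins' theorem) nothing printed covers it, so a late value-level disjoint pair between the two lineages would reopen it.
sources: Platt2016GRH, Chua2005RealZeros, arXiv:2301.10722
for every modulus 4·10⁵ < q ≤ 10⁸, every primitive quadratic EVEN χ mod q and every σ ∈ (0,1),
L(σ,χ) ≠ 0 (250× beyond the printed even range). BOOKED in the route's currency (certified numerics,
two code-disjoint referee-signed lineages; text refreshed 2026-08-26 per tribunal №10 (4), statement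
unchanged): lineage A regime 1 (certify.py; kit j241631/j241633; referee V13 PASS; 60 792 709 rows
both parities) ∧ lineage BW R1-W (bwcert; j242759; 60 549 538 even rows; referee V18 PASSED —
supersedes the earlier «V9 pending» wording). Closing bundle (consolidated BOOKED record) attached
to stmt-Parity-18822; the item stays OPEN+BOOKED (director D1–D3) and closes in the ledger sense
only if a kernel replay lands. -/
@[route_item "route-Parity-RealCharacterDecadeTenEven", crux]
def EvenToHundredMillion : Prop :=
  ∀ (q : ℕ) [NeZero q], 400000 < q → q ≤ 100000000 → ∀ χ : DirichletCharacter ℂ q, χ.IsQuadratic → χ.IsPrimitive → χ.Even → ∀ σ : ℝ, 0 < σ → σ < 1 → χ.LFunction σ ≠ 0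

/-- item stmt-Parity-18824 · support · rank 9 · open · by planner
sources: Platt2016GRH, Watkins2004RealZeros, Chua2005RealZeros
no real zero in (0,1) for every primitive quadratic χ mod 3 ≤ q ≤ 4·10⁵, both parities — Platt's
printed range. RESIDUAL of the route (tribunal №10: tier B on the leaf modulo [PlattRange,
OddToHundredMillion]); CLOSING CURRENCY stated for consumers of NoRealZeroUpTo_1e9 (text refreshed
2026-08-26 per №10 (3), statement unchanged): (i) PRINT, conditional in the kernel — tree
`noRealZeroUpTo_platt` modulo the NAMED FACTS `platt2016_theorem71` / `platt2016_theorem72` (Platt,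
Math. Comp. 85 (2016) Thms 7.1/7.2: GRH to height 10⁸/q for primitive χ, q ≤ 4·10⁵ ⇒ no real zero);
(ii) CERTIFIED NUMERICS — the cell's STEP-0: two code-disjoint integer-certified lineages A
(certify.py, kit j241268) and BW (bwcert, j242447) over all 243 171 fundamental d with 3 ≤ |d| ≤
4·10⁵, referee-signed STEP0-PASS / STEP0-W-PASS with a full value-level join (0 disjoint, worst
separation 0.0244 at d = −907), and lineage C's in-job STEP-0 guards (V59/V68); (iii) KERNEL,
unconditional, sub-ranges only — `noRealZeroUpTo_twentyThree` (q ≤ 23, p403994),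
`noRealZeroOddUpTo_144` (odd q ≤ 144, Epstein class sums), the Fekete–Pólya / Chowla files
(registered skeleton stubs in the decade routes). So a consumer reads: « -/
@[route_item "route-Parity-RealCharacterDecadeTenEven", crux]
def PlattRange : Prop :=
  Literature.NumberTheory.LFunctions.NoRealZeroUpTo 400000

/-- item stmt-Parity-19228 · assembly · rank 1 · open · by planner
sources: Platt2016GRH
[assembly] PlattRange → EvenToHundredMillion → EvenToBillion → EvenLowDecade → EvenHighDecade → no
real zero for even quadratic χ up to 10¹⁰. -/
@[route_item "route-Parity-RealCharacterDecadeTenEven"]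
def Assembly : Prop :=
  PlattRange → EvenToHundredMillion → EvenToBillion → EvenLowDecade → EvenHighDecade → Literature.NumberTheory.LFunctions.NoRealZeroEvenUpTo 10000000000

/-! D-0027 §2.1 — DECIDING THEOREM (planner-authored via `route open/edit --closes-file`; by planner-parity-realchar-theory-g5-0 2026-08-26T02:32:05Z):
its hypotheses are this route's items and its conclusion the registered leaf `Literature.NumberTheory.LFunctions.NoRealZeroEvenUpTo_1e10` (rung F-P2c′, D-0061) (glue_lint), and it elaborates with this file. -/

@[closes "route-Parity-RealCharacterDecadeTenEven"] theorem closes (h0 : PlattRange) (h1e : EvenToHundredMillion) (h2e : EvenToBillion)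
    (h3lo : EvenLowDecade) (h3hi : EvenHighDecade) :
    Literature.NumberTheory.LFunctions.NoRealZeroEvenUpTo_1e10 := by
  show Literature.NumberTheory.LFunctions.NoRealZeroEvenUpTo 10000000000
  intro q _ hq3 hqQ χ hquad hprim heven σ hσ0 hσ1
  by_cases hq0 : q ≤ 400000
  · exact h0 q hq3 hq0 χ hquad hprim σ hσ0 hσ1
  · by_cases hq1 : q ≤ 100000000
    · exact h1e q (by omega) hq1 χ hquad hprim heven σ hσ0 hσ1
    · by_cases hq2 : q ≤ 1000000000
      · exact h2e q (by omega) hq2 χ hquad hprim heven σ hσ0 hσ1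
      · by_cases hq4 : q ≤ 6432000000
        · exact h3lo q (by omega) hq4 χ hquad hprim heven σ hσ0 hσ1
        · exact h3hi q (by omega) hqQ χ hquad hprim heven σ hσ0 hσ1

end Summit.Parity.GeneralizedHardyLittlewood.Theses.RealCharacterDecadeTenEven
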